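import Mathlib
import HarnessLib
import Literature.Analysis.Quadrature.ThreeTermRecurrence

/-!
# Polynomials in Chebyshev form and their evaluation (Clenshaw's backward recurrence)

Source: T. J. Rivlin, *The Chebyshev Polynomials* (Wiley, 1974), Sect. 3.1 "Polynomials in Chebyshev
Form" (pp. 124–125, formulas (3.1)–(3.4)) and Sect. 3.2 "Evaluating Polynomials in Chebyshev Form"
(pp. 125–128, formulas (3.5)–(3.16)). [cite: Rivlin1974]

THE TEXT. Sect. 3.1: `p(x) = 1 + x + ⋯ + x⁵` (3.1) has the Chebyshev form
`p = 15/8 + 19/8 T₁ + T₂ + 9/16 T₃ + 1/8 T₄ + 1/16 T₅` (3.2); the truncations `p₄` (3.3) and `p₃`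
(3.4) ("economizations", Lanczos) satisfy `|p - p₄| ≤ 1/16`, `|p - p₃| ≤ 3/16` on `[-1, 1]`, and
`p₃ = 7/8 + 11/16 x + 2x² + 9/4 x³`, `p₄ = 1 + 11/16 x + x² + 9/4 x³ + x⁴`.
Sect. 3.2: for `q(x) = A₀ + A₁T₁(x) + ⋯ + A_nT_n(x)` the relation `T_n = 2xT_{n-1} - T_{n-2}` folds the
top coefficient into the two below it (3.5); with `B_k = 2xB_{k+1} - B_{k+2} + A_k` (3.6),
`B_{n+1} = B_{n+2} = 0` (3.7) one gets `q(x) = (A₀ - B₂) + B₁x = A₀/2 + (B₀ - B₂)/2` (3.8) and, for the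
primed sum, `p(x) = Σ' A_j T_j(x) = (B₀ - B₂)/2` (3.9). Error analysis (Fox–Parker): a unit local
error at step `k` produces the error `E_m(k)` in `B_m`, the total error in `B_m` being
`Σ_{k=m}^{n} ε_k E_m(k)` (3.10), where `E_m(k) = 2xE_{m+1}(k) - E_{m+2}(k)`, `E_{k+1}(k) = 0`,
`E_k(k) = 1` (3.11), whence `E_m(k) = U_{k-m}(x)`; since `E₀(k) - E₂(k) = U_k - U_{k-2} = 2T_k` the error
in `p(x)` is at most `Σ_{k=0}^{n} |ε_k|` on `[-1, 1]` (the method is *stable*). Even polynomials: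
`T_{2j}(x) = T_j(2x² - 1)`, so `Σ' A_{2j}T_{2j}(x) = Σ' D_jT_j(t)`, `t = 2x² - 1`, `D_j = A_{2j}`
(3.12)–(3.14); odd polynomials: `Σ_{j≤m} C_{2j+1}T_{2j+1}(x) = x(B₀ - B₂)/2` with
`C_{2j+1} = (A_{2j} + A_{2j+2})/2` (3.15), or directly `= x(β₀ - β₁)` with
`β_k = 2tβ_{k+1} - β_{k+2} + C_{2k+1}`, `β_{m+1} = β_{m+2} = 0`, `β_k = (B_k + B_{k+1})/2` (3.16).

WHAT IS FORMALISED (everything below is proved; no named facts), over a commutative ring `R`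
unless a division by `2` (field `K` with `2 ≠ 0`) or an absolute value (`ℝ`) is displayed:
* `clenshawT A x n k = B_k` — the backward recurrence (3.6)–(3.7) as a well-founded definition
  (`B_k = 0` for `k > n`), its uniqueness from the starting values (`clenshawT_unique`), linearity,
  and the bridge `clenshawT_eq_clenshawB` to the tree's general three-term backward recurrence
  `Literature.Analysis.Quadrature.clenshawB` (Davis–Rabinowitz (1.12.9)) with `γ ≡ 2, α ≡ 0, β ≡ 1`.
* The CLOSED FORM `B_m = Σ_{k=m}^{n} A_k U_{k-m}(x)` (`clenshawT_eq_sum_U`; `U` = Mathlib's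
  Chebyshev polynomials of the second kind, `U_{-1} = 0`, `U_{-2} = -1`), which is (3.10)–(3.11) with
  `E_m(k) = U_{k-m}(x)` (`clenshawT_single`, `clenshawT_add_sub_eq_sum`).
* (3.5) `clenshawT_reduced_sum`; (3.8) `clenshawT_two_mul_sum_eq` / `clenshawT_sum_range_eq`
  (`Σ_{k≤n} A_kT_k(x) = A₀ + xB₁ - B₂`, any ring) / `clenshawT_sum_range_eq_div`; (3.9)
  `clenshawT_sum_Ico_eq`, `clenshawT_primedSum_eq`; the hypothesis form
  `clenshawT_sum_range_eq_of_rec` over any commutative ring — for `R = ℝ` this is the tree's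
  `Literature.Analysis.Quadrature.clenshaw_chebyshev_T` (cited, not restated there: that file has
  the general orthogonal-polynomial recurrence, this one the Chebyshev closed form and Sect. 3.2).
* The error analysis: `E₀(0) = 1`, `E₀(1) = 2x`, `E₀(k) - E₂(k) = 2T_k(x)`
  (`clenshawT_single_zero/one`, `clenshawT_single_zero_sub_two`), the value error
  `p̃ - p = ε₀/2 + Σ_{k=1}^{n} ε_kT_k(x)` for the perturbed run `B̃ = clenshawT (A + ε)`
  (`clenshawT_valueError`), and the stability bound `|p̃ - p| ≤ |ε₀|/2 + Σ_{k=1}^{n}|ε_k| ≤ Σ_{k=0}^{n}|ε_k|`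
  on `[-1, 1]` (`clenshawT_abs_valueError_le`, `clenshawT_abs_valueError_le_sum`).
* Even/odd reductions: `eval_T_two_mul` (`T_{2j}(x) = T_j(2x² - 1)`, from Mathlib's `T_mul`),
  (3.12)–(3.14) `evenSum_T_eq`, `clenshawT_two_mul_evenSum_eq`; the polynomial identity
  `T_{2j+1} = X · (U_j - U_{j-1}) ∘ T₂` for all `j ∈ ℤ` (`T_two_mul_add_one`) behind (3.15)–(3.16),
  (3.16) `clenshawT_oddSum_eq` (`Σ_{k≤m} C_{2k+1}T_{2k+1}(x) = x(β₀ - β₁)`), `2β_k = B_k + B_{k+1}`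
  (`clenshawT_pairSum`), (3.15) `clenshawT_oddPairSum_eq`, `two_mul_X_mul_evenSum_T`.
* Sect. 3.1: `econP` (3.1), `sixteen_mul_econP` / `econP_eval` (3.2), `econPFour`, `econPThree` with
  their Chebyshev forms (3.3)–(3.4), and the bounds `abs_econP_sub_econPFour_le` (`≤ 1/16`),
  `abs_econP_sub_econPThree_le` (`≤ 3/16`) on `[-1, 1]` (Mathlib's `abs_eval_T_real_le_one`).

HONEST FRAMING. The text's `(3.8)`/`(3.9)` differ by the prime on the sum (`A₀/2`); both are stated.
Rivlin obtains `E_m(k) = U_{k-m}` from the general solution `A T_m + B U_m` of (3.11) and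
trigonometric identities; here it is read off the closed form, which is proved directly by
descending induction from (3.6). Rounding-error modelling itself (floating point) is not formalised:
`ε_k` is an arbitrary sequence of local errors entering (3.6) additively, exactly as in (3.10).
-/

namespace Literature.Analysis.Approximation.ChebyshevFormEvaluation

open Polynomial Finset
open Polynomial.Chebyshev hiding C

section Ring

variable {R : Type*} [CommRing R]

/-- The backward recurrence (3.6) with starting values (3.7): `B_k = 0` for `k > n`,
`B_k = 2x B_{k+1} - B_{k+2} + A_k` for `k ≤ n`. [cite: Rivlin1974, Sect. 3.2 (3.6)-(3.7)] -/
def clenshawT (A : ℕ → R) (x : R) (n : ℕ) (k : ℕ) : R :=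
  if n < k then 0 else 2 * x * clenshawT A x n (k + 1) - clenshawT A x n (k + 2) + A k
termination_by n + 1 - k
decreasing_by all_goals omega

/-- (3.7): `B_k = 0` above the top index. [cite: Rivlin1974, Sect. 3.2 (3.7)] -/
theorem clenshawT_of_lt {A : ℕ → R} {x : R} {n k : ℕ} (h : n < k) : clenshawT A x n k = 0 := by
  rw [clenshawT]; simp [h]

/-- (3.6): the recurrence step for `k ≤ n`. [cite: Rivlin1974, Sect. 3.2 (3.6)] -/
theorem clenshawT_of_le {A : ℕ → R} {x : R} {n k : ℕ} (h : k ≤ n) :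
    clenshawT A x n k = 2 * x * clenshawT A x n (k + 1) - clenshawT A x n (k + 2) + A k := by
  rw [clenshawT]; simp [Nat.not_lt.mpr h]

/-- `B_n = A_n`. [cite: Rivlin1974, Sect. 3.2 (3.6)-(3.7)] -/
theorem clenshawT_self (A : ℕ → R) (x : R) (n : ℕ) : clenshawT A x n n = A n := by
  rw [clenshawT_of_le le_rfl, clenshawT_of_lt (by omega), clenshawT_of_lt (by omega)]; ring

/-- Uniqueness: (3.6) for `k₀ ≤ k ≤ n` with the starting values (3.7) determines `B_k`,
`k₀ ≤ k ≤ n + 2`. [cite: Rivlin1974, Sect. 3.2 (3.6)-(3.7)] -/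
theorem clenshawT_unique {A : ℕ → R} {x : R} {n k₀ : ℕ} {B : ℕ → R} (h₁ : B (n + 1) = 0)
    (h₂ : B (n + 2) = 0)
    (hrec : ∀ k, k₀ ≤ k → k ≤ n → B k = 2 * x * B (k + 1) - B (k + 2) + A k)
    {k : ℕ} (hk₀ : k₀ ≤ k) (hk : k ≤ n + 2) : B k = clenshawT A x n k := by
  suffices h : ∀ d k, n + 3 - k ≤ d → k₀ ≤ k → k ≤ n + 2 → B k = clenshawT A x n k from
    h _ k le_rfl hk₀ hk
  intro d
  induction d with
  | zero => intro k hk h0 hk'; omega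
  | succ d ih =>
    intro k hk h0 hk'
    rcases Nat.lt_or_ge n k with h | h
    · rw [clenshawT_of_lt h]
      rcases (show k = n + 1 ∨ k = n + 2 by omega) with rfl | rfl
      exacts [h₁, h₂]
    · rw [clenshawT_of_le h, hrec k h0 h, ih (k + 1) (by omega) (by omega) (by omega),
        ih (k + 2) (by omega) (by omega) (by omega)]

/-- Linearity of the run in the data (superposition, used in (3.10)).
[cite: Rivlin1974, Sect. 3.2 (3.6)-(3.7), (3.10)] -/
theorem clenshawT_add (A A' : ℕ → R) (x : R) (n k : ℕ) :
    clenshawT (A + A') x n k = clenshawT A x n k + clenshawT A' x n k := by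
  rcases Nat.lt_or_ge (n + 2) k with hk | hk
  · rw [clenshawT_of_lt (by omega), clenshawT_of_lt (by omega), clenshawT_of_lt (by omega),
      add_zero]
  symm
  refine clenshawT_unique (B := fun k => clenshawT A x n k + clenshawT A' x n k) (k₀ := 0) ?_ ?_
    ?_ (Nat.zero_le _) hk
  · simp [clenshawT_of_lt (show n < n + 1 by omega)]
  · simp [clenshawT_of_lt (show n < n + 2 by omega)]
  · intro k _ hk
    simp only [clenshawT_of_le hk, Pi.add_apply]; ring

/-- Homogeneity of the run in the data. [cite: Rivlin1974, Sect. 3.2 (3.6)-(3.7), (3.10)] -/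
theorem clenshawT_mul (c : R) (A : ℕ → R) (x : R) (n k : ℕ) :
    clenshawT (fun j => c * A j) x n k = c * clenshawT A x n k := by
  rcases Nat.lt_or_ge (n + 2) k with hk | hk
  · rw [clenshawT_of_lt (by omega), clenshawT_of_lt (by omega), mul_zero]
  symm
  refine clenshawT_unique (B := fun k => c * clenshawT A x n k) (k₀ := 0) ?_ ?_ ?_
    (Nat.zero_le _) hk
  · simp [clenshawT_of_lt (show n < n + 1 by omega)]
  · simp [clenshawT_of_lt (show n < n + 2 by omega)]
  · intro k _ hk
    simp only [clenshawT_of_le hk]; ring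

/-- The difference of two runs is the run of the difference of the data (error propagation (3.10)).
[cite: Rivlin1974, Sect. 3.2 (3.10)] -/
theorem clenshawT_sub (A A' : ℕ → R) (x : R) (n k : ℕ) :
    clenshawT (A - A') x n k = clenshawT A x n k - clenshawT A' x n k := by
  have h := clenshawT_add (A - A') A' x n k
  rw [sub_add_cancel] at h
  rw [h]; ring

/-- Index shift: if `A_{n+1} = 0` the run for the data `k ↦ A_{k+1}` is `k ↦ B_{k+1}`
(used for `β_k = (B_k + B_{k+1})/2` in (3.16)). [cite: Rivlin1974, Sect. 3.2 (3.14), (3.16)] -/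
theorem clenshawT_shift {A : ℕ → R} {n : ℕ} (hA : A (n + 1) = 0) (x : R) (k : ℕ) :
    clenshawT (fun j => A (j + 1)) x n k = clenshawT A x n (k + 1) := by
  rcases Nat.lt_or_ge (n + 2) k with hk | hk
  · rw [clenshawT_of_lt (by omega), clenshawT_of_lt (by omega)]
  symm
  refine clenshawT_unique (B := fun k => clenshawT A x n (k + 1)) (k₀ := 0) ?_ ?_ ?_
    (Nat.zero_le _) hk
  · simp [clenshawT_of_lt (show n < n + 1 + 1 by omega)]
  · simp [clenshawT_of_lt (show n < n + 2 + 1 by omega)]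
  · intro k _ hk
    rcases hk.lt_or_eq with hk | hk
    · simp only [clenshawT_of_le (show k + 1 ≤ n by omega)]
    · rw [hk]
      simp only [clenshawT_of_lt (show n < n + 1 by omega),
        clenshawT_of_lt (show n < n + 1 + 1 by omega),
        clenshawT_of_lt (show n < n + 2 + 1 by omega), hA]
      ring

/-- Bridge to the tree's general backward recurrence
`Literature.Analysis.Quadrature.clenshawB γ α β x c N r` (Davis–Rabinowitz (1.12.9)) with the
constant data `γ ≡ 2`, `α ≡ 0`, `β ≡ 1`: the two runs coincide.
[cite: Rivlin1974, Sect. 3.2 (3.6)-(3.7)] -/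
theorem clenshawT_eq_clenshawB (A : ℕ → R) (x : R) (n k : ℕ) :
    clenshawT A x n k =
      Literature.Analysis.Quadrature.clenshawB (fun _ => 2) (fun _ => 0) (fun _ => 1) x A n k := by
  rcases Nat.lt_or_ge (n + 2) k with hk | hk
  · rw [clenshawT_of_lt (by omega), Literature.Analysis.Quadrature.clenshawB_of_lt (by omega)]
  symm
  refine clenshawT_unique (k₀ := 0) (Literature.Analysis.Quadrature.clenshawB_of_lt (by omega))
    (Literature.Analysis.Quadrature.clenshawB_of_lt (by omega)) (fun k _ hk => ?_) (Nat.zero_le _)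
    hk
  rw [Literature.Analysis.Quadrature.clenshawB_of_le hk]; ring

/-- **Closed form of the run**: `B_m = Σ_{k=m}^{n} A_k U_{k-m}(x)` — by superposition this is
`E_m(k) = U_{k-m}(x)` of (3.10)–(3.11). [cite: Rivlin1974, Sect. 3.2 (3.10)-(3.11)] -/
theorem clenshawT_eq_sum_U (A : ℕ → R) (x : R) (n m : ℕ) :
    clenshawT A x n m = ∑ k ∈ Ico m (n + 1), A k * (U R ((k : ℤ) - m)).eval x := by
  suffices h : ∀ d m, n + 1 - m ≤ d →
      clenshawT A x n m = ∑ k ∈ Ico m (n + 1), A k * (U R ((k : ℤ) - m)).eval x from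
    h _ m le_rfl
  intro d
  induction d with
  | zero =>
    intro m hm
    rw [clenshawT_of_lt (by omega), Ico_eq_empty_of_le (by omega), sum_empty]
  | succ d ih =>
    intro m hm
    rcases Nat.lt_or_ge n m with h | h
    · rw [clenshawT_of_lt h, Ico_eq_empty_of_le (by omega), sum_empty]
    · rw [clenshawT_of_le h, ih (m + 1) (by omega), ih (m + 2) (by omega),
        sum_eq_sum_Ico_succ_bot (by omega : m < n + 1)]
      have h0 : ((m : ℕ) : ℤ) - (m : ℕ) = 0 := sub_self _
      rw [h0, U_zero, eval_one, mul_one]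
      rcases h.eq_or_lt with rfl | hlt
      · rw [Ico_eq_empty_of_le (by omega), Ico_eq_empty_of_le (by omega), sum_empty]
        ring
      · have e : ∑ k ∈ Ico (m + 2) (n + 1), A k * (U R ((k : ℤ) - (m + 2 : ℕ))).eval x =
            ∑ k ∈ Ico (m + 1) (n + 1), A k * (U R ((k : ℤ) - (m + 2 : ℕ))).eval x := by
          rw [sum_eq_sum_Ico_succ_bot (by omega : m + 1 < n + 1)]
          have : ((m + 1 : ℕ) : ℤ) - ((m + 2 : ℕ) : ℤ) = -1 := by push_cast; ring
          rw [this, U_neg_one, eval_zero, mul_zero, zero_add]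
        rw [e, mul_sum, ← sum_sub_distrib, add_comm]
        congr 1
        refine sum_congr rfl fun k _ => ?_
        have hU := congrArg (eval x) (U_eq R ((k : ℤ) - m))
        simp only [eval_sub, eval_mul, eval_ofNat, eval_X] at hU
        have e1 : (k : ℤ) - ((m + 1 : ℕ) : ℤ) = (k : ℤ) - m - 1 := by push_cast; ring
        have e2 : (k : ℤ) - ((m + 2 : ℕ) : ℤ) = (k : ℤ) - m - 2 := by push_cast; ring
        rw [e1, e2, hU]
        ring

/-- The closed form with a closed interval of indices: `B_m = Σ_{k ∈ [m, n]} A_k U_{k-m}(x)`.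
[cite: Rivlin1974, Sect. 3.2 (3.10)-(3.11)] -/
theorem clenshawT_eq_sum_Icc_U (A : ℕ → R) (x : R) (n m : ℕ) :
    clenshawT A x n m = ∑ k ∈ Icc m n, A k * (U R ((k : ℤ) - m)).eval x := by
  rw [clenshawT_eq_sum_U]; rfl

/-- (3.5) in terms of the run: after the top `n - m` coefficients have been folded down
(`1 ≤ m ≤ n`, written `m = i + 1`),
`q(x) = Σ_{j<i} A_j T_j(x) + (A_i - B_{i+2}) T_i(x) + B_{i+1} T_{i+1}(x)`; at `i = 0` this is the
display `q(x) = (A₀ - B₂) + B₁ x` before (3.8). [cite: Rivlin1974, Sect. 3.2 (3.5)] -/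
theorem clenshawT_reduced_sum (A : ℕ → R) (x : R) {n i : ℕ} (hi : i + 1 ≤ n) :
    ∑ k ∈ range (n + 1), A k * (T R k).eval x =
      ∑ j ∈ range i, A j * (T R j).eval x
        + (A i - clenshawT A x n (i + 2)) * (T R i).eval x
        + clenshawT A x n (i + 1) * (T R (i + 1 : ℕ)).eval x := by
  suffices h : ∀ d i, n - i ≤ d → i + 1 ≤ n →
      ∑ k ∈ range (n + 1), A k * (T R k).eval x =
        ∑ j ∈ range i, A j * (T R j).eval x
          + (A i - clenshawT A x n (i + 2)) * (T R i).eval x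
          + clenshawT A x n (i + 1) * (T R (i + 1 : ℕ)).eval x from h _ i le_rfl hi
  intro d
  induction d with
  | zero => intro i h1 h2; omega
  | succ d ih =>
    intro i h1 h2
    rcases h2.eq_or_lt with h | h
    · subst h
      rw [sum_range_succ, sum_range_succ, clenshawT_of_lt (show i + 1 < i + 2 by omega),
        clenshawT_self, sub_zero]
    · rw [ih (i + 1) (by omega) (by omega), clenshawT_of_le (show i + 1 ≤ n by omega)]
      simp only [show i + 1 + 1 = i + 2 from rfl, show i + 1 + 2 = i + 3 from rfl]
      have hT : (T R ((i + 2 : ℕ) : ℤ)).eval x =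
          2 * x * (T R ((i + 1 : ℕ) : ℤ)).eval x - (T R (i : ℤ)).eval x := by
        have e := congrArg (eval x) (T_add_two R i)
        simp only [eval_sub, eval_mul, eval_ofNat, eval_X] at e
        push_cast
        exact e
      rw [sum_range_succ, hT]
      ring

/-- `Σ_{k=1}^{n} A_k T_k(x) = (B₀ - A₀) - x B₁` (from the closed form and `T_k = U_k - x U_{k-1}`).
[cite: Rivlin1974, Sect. 3.2 (3.8)-(3.9)] -/
theorem clenshawT_sum_Ico_eq' (A : ℕ → R) (x : R) (n : ℕ) :
    ∑ k ∈ Ico 1 (n + 1), A k * (T R k).eval x =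
      clenshawT A x n 0 - A 0 - x * clenshawT A x n 1 := by
  rw [clenshawT_eq_sum_U, clenshawT_eq_sum_U, sum_eq_sum_Ico_succ_bot (by omega : 0 < n + 1)]
  simp only [Nat.cast_zero, Nat.cast_one, sub_zero, sub_self, U_zero, eval_one, mul_one,
    add_sub_cancel_left, zero_add, mul_sum, ← sum_sub_distrib]
  refine sum_congr rfl fun k _ => ?_
  have hT := congrArg (eval x) (T_eq_U_sub_X_mul_U R (k : ℤ))
  simp only [eval_sub, eval_mul, eval_X] at hT
  rw [hT]; ring

/-- (3.9), cleared of the `2`: `Σ_{k=1}^{n} A_k T_k(x) = x B₁ - B₂`.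
[cite: Rivlin1974, Sect. 3.2 (3.8)-(3.9)] -/
theorem clenshawT_sum_Ico_eq (A : ℕ → R) (x : R) (n : ℕ) :
    ∑ k ∈ Ico 1 (n + 1), A k * (T R k).eval x = x * clenshawT A x n 1 - clenshawT A x n 2 := by
  rw [clenshawT_sum_Ico_eq', clenshawT_of_le (Nat.zero_le n)]; ring

/-- (3.8), cleared of the `2`: `2 q(x) = 2 Σ_{k=0}^{n} A_k T_k(x) = A₀ + B₀ - B₂`.
[cite: Rivlin1974, Sect. 3.2 (3.8)] -/
theorem clenshawT_two_mul_sum_eq (A : ℕ → R) (x : R) (n : ℕ) :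
    2 * ∑ k ∈ range (n + 1), A k * (T R k).eval x =
      A 0 + clenshawT A x n 0 - clenshawT A x n 2 := by
  rw [range_eq_Ico, sum_eq_sum_Ico_succ_bot (by omega : 0 < n + 1), zero_add, clenshawT_sum_Ico_eq,
    clenshawT_of_le (Nat.zero_le n)]
  simp only [Nat.cast_zero, T_zero, eval_one, mul_one]
  ring

/-- The display before (3.8): `q(x) = Σ_{k=0}^{n} A_k T_k(x) = A₀ + x B₁ - B₂`.
[cite: Rivlin1974, Sect. 3.2 (3.8)] -/
theorem clenshawT_sum_range_eq (A : ℕ → R) (x : R) (n : ℕ) :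
    ∑ k ∈ range (n + 1), A k * (T R k).eval x =
      A 0 + x * clenshawT A x n 1 - clenshawT A x n 2 := by
  rw [range_eq_Ico, sum_eq_sum_Ico_succ_bot (by omega : 0 < n + 1), zero_add, clenshawT_sum_Ico_eq]
  simp only [Nat.cast_zero, T_zero, eval_one, mul_one]
  ring

/-- Hypothesis form over any commutative ring (the tree's
`Literature.Analysis.Quadrature.clenshaw_chebyshev_T` is the case `R = ℝ`): if
`B_{n+1} = B_{n+2} = 0` and `B_r = A_r + 2x B_{r+1} - B_{r+2}` for `1 ≤ r ≤ n` then
`Σ_{r=0}^{n} A_r T_r(x) = A₀ + x B₁ - B₂`. [cite: Rivlin1974, Sect. 3.2 (3.6)-(3.8)] -/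
theorem clenshawT_sum_range_eq_of_rec (A : ℕ → R) (x : R) (n : ℕ) {B : ℕ → R}
    (hB₁ : B (n + 1) = 0) (hB₂ : B (n + 2) = 0)
    (hB : ∀ r, 1 ≤ r → r ≤ n → B r = A r + 2 * x * B (r + 1) - B (r + 2)) :
    ∑ k ∈ range (n + 1), A k * (T R k).eval x = A 0 + x * B 1 - B 2 := by
  have hu : ∀ {k}, 1 ≤ k → k ≤ n + 2 → B k = clenshawT A x n k := fun hk₀ hk =>
    clenshawT_unique (k₀ := 1) hB₁ hB₂ (fun r h1 hr => by rw [hB r h1 hr]; ring) hk₀ hk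
  rw [clenshawT_sum_range_eq, hu le_rfl (by omega), hu (by norm_num) (by omega)]

/-! ### Error propagation (3.10)–(3.11) -/

/-- `E_m(k) = U_{k-m}(x)` (`m ≤ k ≤ n`; zero otherwise): the response of `B_m` to a unit local
error at step `k`, i.e. the run with data `δ_k`. [cite: Rivlin1974, Sect. 3.2 (3.11)] -/
theorem clenshawT_single (x : R) (n k m : ℕ) :
    clenshawT (Pi.single k 1) x n m =
      if m ≤ k ∧ k ≤ n then (U R ((k : ℤ) - m)).eval x else 0 := by
  rw [clenshawT_eq_sum_U]
  simp only [Pi.single_apply, ite_mul, one_mul, zero_mul, sum_ite_eq', mem_Ico, Nat.lt_succ_iff]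

/-- (3.10): with local errors `ε_k` entering (3.6) additively, the total error in `B_m` is
`Σ_{k=m}^{n} ε_k E_m(k) = Σ_{k=m}^{n} ε_k U_{k-m}(x)`. [cite: Rivlin1974, Sect. 3.2 (3.10)-(3.11)] -/
theorem clenshawT_add_sub_eq_sum (A ε : ℕ → R) (x : R) (n m : ℕ) :
    clenshawT (A + ε) x n m - clenshawT A x n m =
      ∑ k ∈ Ico m (n + 1), ε k * (U R ((k : ℤ) - m)).eval x := by
  rw [clenshawT_add, add_sub_cancel_left, clenshawT_eq_sum_U]

/-- `E₀(0) = 1`. [cite: Rivlin1974, Sect. 3.2 (3.11)] -/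
theorem clenshawT_single_zero (x : R) (n : ℕ) : clenshawT (Pi.single 0 1) x n 0 = 1 := by
  rw [clenshawT_single]; simp

/-- `E₀(1) = 2x` (`n ≥ 1`). [cite: Rivlin1974, Sect. 3.2 (3.11)] -/
theorem clenshawT_single_one (x : R) {n : ℕ} (hn : 1 ≤ n) :
    clenshawT (Pi.single 1 1) x n 0 = 2 * x := by
  rw [clenshawT_single, if_pos ⟨by omega, hn⟩]; simp [U_one]

/-- `E₀(k) - E₂(k) = U_k(x) - U_{k-2}(x) = 2 T_k(x)` for `1 ≤ k ≤ n` (for `k = 1`: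
`U₁ - 0 = 2x = 2T₁`). [cite: Rivlin1974, Sect. 3.2 (3.11)] -/
theorem clenshawT_single_zero_sub_two (x : R) {n k : ℕ} (hk : 1 ≤ k) (hkn : k ≤ n) :
    clenshawT (Pi.single k 1) x n 0 - clenshawT (Pi.single k 1) x n 2 =
      2 * (T R k).eval x := by
  rw [clenshawT_single, clenshawT_single, if_pos ⟨by omega, hkn⟩]
  rcases hk.eq_or_lt with rfl | hk2
  · rw [if_neg (by omega)]; simp [U_one]
  · rw [if_pos ⟨by omega, hkn⟩]
    have hT := congrArg (eval x) (two_mul_T_eq_U_sub_U R ((k : ℤ) - 2))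
    simp only [sub_add_cancel, eval_sub, eval_mul, eval_ofNat] at hT
    push_cast
    rw [sub_zero, hT]

/-- The error in the value, cleared of the `2`: for the perturbed run `B̃ = clenshawT (A + ε)`,
`(B̃₀ - B̃₂) - (B₀ - B₂) = ε₀ + 2 Σ_{k=1}^{n} ε_k T_k(x)`
(`= ε₀E₀(0) + ε₁E₀(1) + Σ_{k≥2} ε_k (E₀(k) - E₂(k))`). [cite: Rivlin1974, Sect. 3.2 (3.9)-(3.11)] -/
theorem clenshawT_valueError_two_mul (A ε : ℕ → R) (x : R) (n : ℕ) :
    (clenshawT (A + ε) x n 0 - clenshawT (A + ε) x n 2) -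
        (clenshawT A x n 0 - clenshawT A x n 2) =
      ε 0 + 2 * ∑ k ∈ Ico 1 (n + 1), ε k * (T R k).eval x := by
  have h := clenshawT_two_mul_sum_eq ε x n
  rw [range_eq_Ico, sum_eq_sum_Ico_succ_bot (by omega : 0 < n + 1), zero_add] at h
  simp only [Nat.cast_zero, T_zero, eval_one, mul_one] at h
  rw [clenshawT_add, clenshawT_add]
  linear_combination -h

end Ring

section Field

variable {K : Type*} [Field K] [NeZero (2 : K)]

/-- (3.8): `q(x) = Σ_{k=0}^{n} A_k T_k(x) = A₀/2 + (B₀ - B₂)/2`. [cite: Rivlin1974, Sect. 3.2 (3.8)] -/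
theorem clenshawT_sum_range_eq_div (A : ℕ → K) (x : K) (n : ℕ) :
    ∑ k ∈ range (n + 1), A k * (T K k).eval x =
      A 0 / 2 + (clenshawT A x n 0 - clenshawT A x n 2) / 2 := by
  have h := clenshawT_two_mul_sum_eq A x n
  have h2 : (2 : K) ≠ 0 := two_ne_zero
  field_simp
  linear_combination h

/-- (3.9): the primed sum `p(x) = A₀/2 + Σ_{k=1}^{n} A_k T_k(x) = (B₀ - B₂)/2`.
[cite: Rivlin1974, Sect. 3.2 (3.9)] -/
theorem clenshawT_primedSum_eq (A : ℕ → K) (x : K) (n : ℕ) :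
    A 0 / 2 + ∑ k ∈ Ico 1 (n + 1), A k * (T K k).eval x =
      (clenshawT A x n 0 - clenshawT A x n 2) / 2 := by
  have h := clenshawT_sum_Ico_eq A x n
  have h2 : (2 : K) ≠ 0 := two_ne_zero
  rw [clenshawT_of_le (Nat.zero_le n)]
  field_simp
  linear_combination 2 * h

/-- The error in the value `p = (B₀ - B₂)/2` of (3.9) caused by local errors `ε_k` in (3.6):
`p̃ - p = ε₀/2 + Σ_{k=1}^{n} ε_k T_k(x)`. [cite: Rivlin1974, Sect. 3.2 (3.9)-(3.11)] -/
theorem clenshawT_valueError (A ε : ℕ → K) (x : K) (n : ℕ) :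
    (clenshawT (A + ε) x n 0 - clenshawT (A + ε) x n 2) / 2 -
        (clenshawT A x n 0 - clenshawT A x n 2) / 2 =
      ε 0 / 2 + ∑ k ∈ Ico 1 (n + 1), ε k * (T K k).eval x := by
  have h := clenshawT_valueError_two_mul A ε x n
  have h2 : (2 : K) ≠ 0 := two_ne_zero
  field_simp
  linear_combination h

end Field

section Real

/-- **Stability** of the backward recurrence on `[-1, 1]`: the value error is at most
`|ε₀|/2 + Σ_{k=1}^{n} |ε_k|`. [cite: Rivlin1974, Sect. 3.2 (3.10)-(3.11)] -/
theorem clenshawT_abs_valueError_le (A ε : ℕ → ℝ) {x : ℝ} (hx : |x| ≤ 1) (n : ℕ) :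
    |(clenshawT (A + ε) x n 0 - clenshawT (A + ε) x n 2) / 2 -
        (clenshawT A x n 0 - clenshawT A x n 2) / 2| ≤
      |ε 0| / 2 + ∑ k ∈ Ico 1 (n + 1), |ε k| := by
  rw [clenshawT_valueError]
  refine (abs_add_le _ _).trans (add_le_add (by rw [abs_div, abs_two]) ?_)
  refine (abs_sum_le_sum_abs _ _).trans (sum_le_sum fun k _ => ?_)
  rw [abs_mul]
  exact mul_le_of_le_one_right (abs_nonneg _) (abs_eval_T_real_le_one _ hx)

/-- Rivlin's final bound: the error in `p(x)` is no larger than `Σ_{k=0}^{n} |ε_k|`, the sum of the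
absolute values of the local errors. [cite: Rivlin1974, Sect. 3.2 (3.10)-(3.11)] -/
theorem clenshawT_abs_valueError_le_sum (A ε : ℕ → ℝ) {x : ℝ} (hx : |x| ≤ 1) (n : ℕ) :
    |(clenshawT (A + ε) x n 0 - clenshawT (A + ε) x n 2) / 2 -
        (clenshawT A x n 0 - clenshawT A x n 2) / 2| ≤
      ∑ k ∈ range (n + 1), |ε k| := by
  refine (clenshawT_abs_valueError_le A ε hx n).trans ?_
  rw [range_eq_Ico, sum_eq_sum_Ico_succ_bot (by omega : 0 < n + 1), zero_add]
  have : |ε 0| / 2 ≤ |ε 0| := by linarith [abs_nonneg (ε 0)]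
  linarith

end Real

/-! ### Even and odd polynomials (3.12)–(3.16) -/

section EvenOdd

variable {R : Type*} [CommRing R]

/-- `T_{2j}(x) = T_j(T₂(x)) = T_j(2x² - 1)` (Mathlib's `T_mul`). [cite: Rivlin1974, Sect. 3.2 (3.12)-(3.13)] -/
theorem eval_T_two_mul (x : R) (j : ℤ) :
    (T R (2 * j)).eval x = (T R j).eval (2 * x ^ 2 - 1) := by
  rw [mul_comm, T_mul, eval_comp, T_two]
  simp

/-- (3.12)–(3.13): an even polynomial in Chebyshev form is a Chebyshev form in `t = 2x² - 1`:
`Σ_{j≤m} D_j T_{2j}(x) = Σ_{j≤m} D_j T_j(t)`. [cite: Rivlin1974, Sect. 3.2 (3.12)-(3.13)] -/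
theorem evenSum_T_eq (D : ℕ → R) (x : R) (m : ℕ) :
    ∑ j ∈ range (m + 1), D j * (T R (2 * (j : ℤ))).eval x =
      ∑ j ∈ range (m + 1), D j * (T R j).eval (2 * x ^ 2 - 1) := by
  refine sum_congr rfl fun j _ => ?_
  rw [eval_T_two_mul]

/-- (3.14): `2 Σ_{j≤m} D_j T_{2j}(x) = D₀ + B₀ - B₂` for the run with data `D` at `t = 2x² - 1`.
[cite: Rivlin1974, Sect. 3.2 (3.13)-(3.14)] -/
theorem clenshawT_two_mul_evenSum_eq (D : ℕ → R) (x : R) (m : ℕ) :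
    2 * ∑ j ∈ range (m + 1), D j * (T R (2 * (j : ℤ))).eval x =
      D 0 + clenshawT D (2 * x ^ 2 - 1) m 0 - clenshawT D (2 * x ^ 2 - 1) m 2 := by
  rw [evenSum_T_eq, clenshawT_two_mul_sum_eq]

/-- The odd Chebyshev polynomials through `t = T₂`: `T_{2j+1} = X · ((U_j - U_{j-1}) ∘ T₂)` for every
`j ∈ ℤ` (the identity behind (3.15)–(3.16)). [cite: Rivlin1974, Sect. 3.2 (3.15)-(3.16)] -/
theorem T_two_mul_add_one (j : ℤ) :
    T R (2 * j + 1) = X * (U R j - U R (j - 1)).comp (T R 2) := by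
  induction j using Polynomial.Chebyshev.induct with
  | zero => simp [U_neg_one]
  | one =>
    have h3 : T R 3 = 2 * X * T R 2 - T R 1 := by simpa using T_add_two R 1
    rw [show (2 : ℤ) * 1 + 1 = 3 by norm_num, show (1 : ℤ) - 1 = 0 by norm_num, h3, T_two, T_one,
      U_one, U_zero]
    simp only [sub_comp, mul_comp, ofNat_comp, X_comp, one_comp]
    ring
  | add_two n ih1 ih2 =>
    have h₁ := T_mul_T R (2 * ((n : ℤ) + 1) + 1) 2
    have h₂ := congr_arg (comp · (T R 2)) <| U_add_two R (n : ℤ)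
    have h₃ := congr_arg (comp · (T R 2)) <| U_add_one R (n : ℤ)
    simp only [sub_comp, mul_comp, ofNat_comp, X_comp] at h₂ h₃ ih1 ih2 ⊢
    linear_combination (norm := ring_nf) (-1 : R[X]) * h₁ + 2 * T R 2 * ih1 - ih2 -
      (X : R[X]) * h₂ + (X : R[X]) * h₃
  | neg_add_one n ih1 ih2 =>
    have h₁ := T_mul_T R (2 * (-(n : ℤ)) + 1) 2
    have h₂ := congr_arg (comp · (T R 2)) <| U_sub_one R (-(n : ℤ) - 1)
    have h₃ := congr_arg (comp · (T R 2)) <| U_add_one R (-(n : ℤ))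
    simp only [sub_comp, mul_comp, ofNat_comp, X_comp] at h₂ h₃ ih1 ih2 ⊢
    linear_combination (norm := ring_nf) (-1 : R[X]) * h₁ + 2 * T R 2 * ih1 - ih2 +
      (X : R[X]) * h₂ - (X : R[X]) * h₃

/-- `T_{2j+1}(x) = x (U_j(t) - U_{j-1}(t))`, `t = 2x² - 1`. [cite: Rivlin1974, Sect. 3.2 (3.15)-(3.16)] -/
theorem eval_T_two_mul_add_one (x : R) (j : ℤ) :
    (T R (2 * j + 1)).eval x =
      x * ((U R j).eval (2 * x ^ 2 - 1) - (U R (j - 1)).eval (2 * x ^ 2 - 1)) := by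
  rw [T_two_mul_add_one, eval_mul, eval_X, eval_comp, T_two]
  simp

/-- **(3.16)**: an odd polynomial `Σ_{k≤m} C_{2k+1} T_{2k+1}(x)` has the value `x (β₀ - β₁)`, `β`
the run of (3.6) with data `C_{2k+1}` at the point `t = 2x² - 1` (here `C k` stands for
`C_{2k+1}`). [cite: Rivlin1974, Sect. 3.2 (3.16)] -/
theorem clenshawT_oddSum_eq (C : ℕ → R) (x : R) (m : ℕ) :
    ∑ k ∈ range (m + 1), C k * (T R (2 * (k : ℤ) + 1)).eval x =
      x * (clenshawT C (2 * x ^ 2 - 1) m 0 - clenshawT C (2 * x ^ 2 - 1) m 1) := by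
  have e : ∑ k ∈ Ico 1 (m + 1), C k * (U R ((k : ℤ) - (1 : ℕ))).eval (2 * x ^ 2 - 1) =
      ∑ k ∈ Ico 0 (m + 1), C k * (U R ((k : ℤ) - (1 : ℕ))).eval (2 * x ^ 2 - 1) := by
    rw [sum_eq_sum_Ico_succ_bot (by omega : 0 < m + 1)]
    simp [U_neg_one]
  rw [clenshawT_eq_sum_U, clenshawT_eq_sum_U, e, ← range_eq_Ico, ← sum_sub_distrib, mul_sum]
  refine sum_congr rfl fun k _ => ?_
  simp only [Nat.cast_zero, Nat.cast_one, sub_zero]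
  rw [eval_T_two_mul_add_one]
  ring

/-- `β_k = (B_k + B_{k+1})/2` in (3.16), cleared of the `2`: the run with data `D_k + D_{k+1}`
(`= 2C_{2k+1}`) is `B_k + B_{k+1}`, `B` the run with data `D` (`D_{m+1} = 0`).
[cite: Rivlin1974, Sect. 3.2 (3.16)] -/
theorem clenshawT_pairSum {D : ℕ → R} {m : ℕ} (hD : D (m + 1) = 0) (t : R) (k : ℕ) :
    clenshawT (fun j => D j + D (j + 1)) t m k = clenshawT D t m k + clenshawT D t m (k + 1) := by
  rw [← clenshawT_shift hD t k, ← clenshawT_add]; rfl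

/-- **(3.15)**, cleared of the `2`: `Σ_{j≤m} (A_{2j} + A_{2j+2}) T_{2j+1}(x) = x (B₀ - B₂)`, `B` the run
(3.14) with data `D_j = A_{2j}` at `t = 2x² - 1`, `D_{m+1} = A_{2m+2} = 0`.
[cite: Rivlin1974, Sect. 3.2 (3.14)-(3.15)] -/
theorem clenshawT_oddPairSum_eq {D : ℕ → R} {m : ℕ} (hD : D (m + 1) = 0) (x : R) :
    ∑ j ∈ range (m + 1), (D j + D (j + 1)) * (T R (2 * (j : ℤ) + 1)).eval x =
      x * (clenshawT D (2 * x ^ 2 - 1) m 0 - clenshawT D (2 * x ^ 2 - 1) m 2) := by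
  rw [clenshawT_oddSum_eq (fun j => D j + D (j + 1)) x m, clenshawT_pairSum hD,
    clenshawT_pairSum hD]
  ring

/-- `x p(x)` for the even `p` of (3.12), cleared of the `2`:
`2x Σ_{j≤m} D_j T_{2j}(x) = D₀ x + Σ_{j≤m} (D_j + D_{j+1}) T_{2j+1}(x)` (`D_{m+1} = 0`), i.e.
`x Σ' A_{2j} T_{2j}(x) = Σ_j C_{2j+1} T_{2j+1}(x)` with `C_{2j+1} = (A_{2j} + A_{2j+2})/2`.
[cite: Rivlin1974, Sect. 3.2 (3.12), (3.15)] -/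
theorem two_mul_X_mul_evenSum_T {D : ℕ → R} {m : ℕ} (hD : D (m + 1) = 0) (x : R) :
    2 * x * ∑ j ∈ range (m + 1), D j * (T R (2 * (j : ℤ))).eval x =
      D 0 * x + ∑ j ∈ range (m + 1), (D j + D (j + 1)) * (T R (2 * (j : ℤ) + 1)).eval x := by
  rw [clenshawT_oddPairSum_eq hD, mul_comm (2 : R) x, mul_assoc, clenshawT_two_mul_evenSum_eq]
  ring

end EvenOdd

/-! ### Sect. 3.1: the economization example (3.1)–(3.4) -/

section Economization

variable (R : Type*) [CommRing R]

/-- (3.1): `p(x) = 1 + x + x² + x³ + x⁴ + x⁵`. [cite: Rivlin1974, Sect. 3.1 (3.1)] -/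
noncomputable def econP : R[X] := 1 + X + X ^ 2 + X ^ 3 + X ^ 4 + X ^ 5

variable {R}

/-- `T₃ = 2X T₂ - T₁` (Mathlib `T_add_two`). [folklore] -/
private theorem T_three : T R 3 = 2 * X * T R 2 - T R 1 := by simpa using T_add_two R 1

/-- `T₄ = 2X T₃ - T₂` (Mathlib `T_add_two`). [folklore] -/
private theorem T_four : T R 4 = 2 * X * T R 3 - T R 2 := by simpa using T_add_two R 2

/-- `T₅ = 2X T₄ - T₃` (Mathlib `T_add_two`). [folklore] -/
private theorem T_five : T R 5 = 2 * X * T R 4 - T R 3 := by simpa using T_add_two R 3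

/-- (3.2), cleared of denominators (any commutative ring):
`16 p = 30 + 38 T₁ + 16 T₂ + 9 T₃ + 2 T₄ + T₅`. [cite: Rivlin1974, Sect. 3.1 (3.2)] -/
theorem sixteen_mul_econP :
    16 * econP R = 30 + 38 * T R 1 + 16 * T R 2 + 9 * T R 3 + 2 * T R 4 + T R 5 := by
  rw [T_five, T_four, T_three, T_two, T_one, econP]; ring

variable {K : Type*} [Field K] [CharZero K]

/-- (3.2): `p(x) = 15/8 + 19/8 T₁(x) + T₂(x) + 9/16 T₃(x) + 1/8 T₄(x) + 1/16 T₅(x)`.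
[cite: Rivlin1974, Sect. 3.1 (3.2)] -/
theorem econP_eval (x : K) :
    (econP K).eval x = 15 / 8 + 19 / 8 * (T K 1).eval x + (T K 2).eval x +
      9 / 16 * (T K 3).eval x + 1 / 8 * (T K 4).eval x + 1 / 16 * (T K 5).eval x := by
  have h := congrArg (eval x) (sixteen_mul_econP (R := K))
  simp only [eval_mul, eval_ofNat, eval_add] at h
  linear_combination h / 16

variable (K) in
/-- (3.3) in power form: `p₄(x) = 1 + 11/16 x + x² + 9/4 x³ + x⁴`. [cite: Rivlin1974, Sect. 3.1 (3.3)] -/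
noncomputable def econPFour : K[X] :=
  1 + Polynomial.C (11 / 16) * X + X ^ 2 + Polynomial.C (9 / 4) * X ^ 3 + X ^ 4

variable (K) in
/-- (3.4) in power form: `p₃(x) = 7/8 + 11/16 x + 2x² + 9/4 x³`. [cite: Rivlin1974, Sect. 3.1 (3.4)] -/
noncomputable def econPThree : K[X] :=
  Polynomial.C (7 / 8) + Polynomial.C (11 / 16) * X + 2 * X ^ 2 + Polynomial.C (9 / 4) * X ^ 3

/-- (3.3): `p₄ = 15/8 + 19/8 T₁ + T₂ + 9/16 T₃ + 1/8 T₄` (the truncation of (3.2) after `T₄`).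
[cite: Rivlin1974, Sect. 3.1 (3.3)] -/
theorem econPFour_eval (x : K) :
    (econPFour K).eval x = 15 / 8 + 19 / 8 * (T K 1).eval x + (T K 2).eval x +
      9 / 16 * (T K 3).eval x + 1 / 8 * (T K 4).eval x := by
  simp only [econPFour, T_four, T_three, T_two, T_one, eval_add, eval_mul, eval_pow, eval_C,
    eval_X, eval_sub, eval_ofNat, eval_one]
  ring

/-- (3.4): `p₃ = 15/8 + 19/8 T₁ + T₂ + 9/16 T₃` (the truncation of (3.2) after `T₃`).
[cite: Rivlin1974, Sect. 3.1 (3.4)] -/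
theorem econPThree_eval (x : K) :
    (econPThree K).eval x = 15 / 8 + 19 / 8 * (T K 1).eval x + (T K 2).eval x +
      9 / 16 * (T K 3).eval x := by
  simp only [econPThree, T_three, T_two, T_one, eval_add, eval_mul, eval_pow, eval_C, eval_X,
    eval_sub, eval_ofNat, eval_one]
  ring

/-- `p - p₄ = T₅/16`. [cite: Rivlin1974, Sect. 3.1 (3.2)-(3.3)] -/
theorem econP_sub_econPFour_eval (x : K) :
    (econP K).eval x - (econPFour K).eval x = 1 / 16 * (T K 5).eval x := by
  rw [econP_eval, econPFour_eval]; ring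

/-- `p - p₃ = T₄/8 + T₅/16`. [cite: Rivlin1974, Sect. 3.1 (3.2), (3.4)] -/
theorem econP_sub_econPThree_eval (x : K) :
    (econP K).eval x - (econPThree K).eval x =
      1 / 8 * (T K 4).eval x + 1 / 16 * (T K 5).eval x := by
  rw [econP_eval, econPThree_eval]; ring

/-- `|p(x) - p₄(x)| ≤ 1/16` for `-1 ≤ x ≤ 1`. [cite: Rivlin1974, Sect. 3.1 (3.3)] -/
theorem abs_econP_sub_econPFour_le {x : ℝ} (hx : |x| ≤ 1) :
    |(econP ℝ).eval x - (econPFour ℝ).eval x| ≤ 1 / 16 := by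
  rw [econP_sub_econPFour_eval, abs_mul, abs_of_pos (by norm_num : (0 : ℝ) < 1 / 16)]
  have := abs_eval_T_real_le_one 5 hx
  linarith

/-- `|p(x) - p₃(x)| ≤ 3/16` for `-1 ≤ x ≤ 1`. [cite: Rivlin1974, Sect. 3.1 (3.4)] -/
theorem abs_econP_sub_econPThree_le {x : ℝ} (hx : |x| ≤ 1) :
    |(econP ℝ).eval x - (econPThree ℝ).eval x| ≤ 3 / 16 := by
  rw [econP_sub_econPThree_eval]
  have h4 := abs_eval_T_real_le_one 4 hx
  have h5 := abs_eval_T_real_le_one 5 hx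
  refine (abs_add_le _ _).trans ?_
  rw [abs_mul, abs_mul, abs_of_pos (by norm_num : (0 : ℝ) < 1 / 8),
    abs_of_pos (by norm_num : (0 : ℝ) < 1 / 16)]
  linarith

end Economization

end Literature.Analysis.Approximation.ChebyshevFormEvaluation
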